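import Literature.IUT.HodgeArakelov.AbsTopMonoidsGenuineGhatTopology
import HarnessLib

/-!
# [IUTchII] Example 1.8 (vii) `(∗ĝp)` GENUINE, the ind-topology (proofs): `η` has DENSE image — the levels
# `((k̄^×)^J)^∧` are profinite COMPLETIONS of the `J`-invariants, and `η(k̄^×)` is dense in `O^ĝp`

S. Mochizuki, *Inter-universal Teichmüller theory II*, §1, Example 1.8 (vii), kurims manuscript (Dec. 2020) p. 40 ("inductive
limits of profinite completions of the `J`-invariants") [claim: Mochizuki2012, status: disputed] (IUTchII §1 Ex 1.8 (vii),
kurims p.40); J. Neukirch, *Algebraic Number Theory* (1999), Ch. IV §2 p. 274 (the profinite completion `Ĝ = lim G/N` and the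
canonical map `G → Ĝ` with dense image) [cite: NeukirchANT1999, Ch. IV §2 p.274].  abc-iut cell, layer L6, proof-only sequel
«GHATGP-DENSITY» of row «GHATGP-TOPOLOGY» (abc-iut-L6-lead gen 5 GO §F v1.19ay (1); self-named in-fit sequel announced on STATUS);
seat abc-iut-L6-d2 (gen 7).  Nodes IUTchII:Ex1.8(vii), IUTchII:Rmk1.11.1(i).

With the topology of `AbsTopMonoidsGenuineGhatTopology.lean` (p460068: `Â = lim_n A/Aⁿ` carries `⨅_n induced (component n) ⊥`):
* `PowCompletion.nhds_eq_iInf_principal` — the neighbourhood filter of `x ∈ Â` is `⨅_n 𝓟 {y | y_n = x_n}`; `PowCompletion.mem_nhds_iff`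
  — the component fibres `{y | y_n = x_n}` form a neighbourhood BASIS (directed along divisibility: the `mn`-fibre refines the
  `m`- and `n`-fibres, `fiber_subset_of_dvd`);
* **`PowCompletion.denseRange_of`** — `η : A → Â` has DENSE image (every fibre `{y | y_n = x_n}` contains `η(a)` for a lift `a` of
  `x_n ∈ A/Aⁿ`).  Together with `compactSpace_of_finite` (p460068) and `of_injective` (p442510) this says: for `A/Aⁿ` finite and
  `⋂_n Aⁿ = 1`, `η : A ↪ Â` is a dense embedding of `A` into a profinite group — `Â` IS the profinite (power) completion;
* at the genuine `(∗ĝp)`: `Genuine.denseRange_of_level` (each `η_J : (k̄^×)^J → ((k̄^×)^J)^∧` has dense image) and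
  **`Genuine.denseRange_toOghat`** — `η(k̄^×)` is DENSE in `O^ĝp = lim→_J ((k̄^×)^J)^∧` for the colimit topology (each level's
  image lies in the closure of `η` of its invariants, `map_mem_closure` along the continuous structure map).

HONEST FRAMING: classical point-set topology over OUR typed objects; record-anchored to a disputed corpus through the locators only;
nothing here bears on [IUTchIII] Cor. 3.12; typed ≠ proved elsewhere.
-/

set_option autoImplicit false

noncomputable section

namespace Literature.IUT.HodgeArakelov

open Topology Filter

universe u

namespace PowCompletion

variable {A : Type u} [CommGroup A]

/-- The neighbourhood filter of `x ∈ Â`: `⨅_n 𝓟 {y | y_n = x_n}` (each `A/Aⁿ` discrete). [cite: NeukirchANT1999, Ch. IV §2 p.274] -/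
theorem nhds_eq_iInf_principal (x : PowCompletion A) :
    𝓝 x = ⨅ n : ℕ+, 𝓟 {y : PowCompletion A | component n y = component n x} := by
  change @nhds _ (⨅ n : ℕ+, TopologicalSpace.induced (component n) ⊥) x = _
  rw [nhds_iInf]
  refine iInf_congr fun n => ?_
  rw [@nhds_induced _ _ ⊥ (component n) x, @nhds_discrete _ ⊥ (discreteTopology_bot _), comap_pure]
  rfl

/-- The `n`-fibre refines the `m`-fibre for `m ∣ n` (compatibility of the components). [cite: NeukirchANT1999, Ch. IV §2 p.274] -/
theorem fiber_subset_of_dvd (x : PowCompletion A) {m n : ℕ+} (h : (m : ℕ) ∣ n) :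
    {y : PowCompletion A | component n y = component n x} ⊆ {y | component m y = component m x} := by
  intro y hy
  change component m y = component m x
  rw [← component_compat y m n h, ← component_compat x m n h]
  exact congrArg (proj A m n h) hy

/-- **Neighbourhood basis**: `U` is a neighbourhood of `x ∈ Â` iff it contains a component fibre `{y | y_n = x_n}`.
[cite: NeukirchANT1999, Ch. IV §2 p.274] -/
theorem mem_nhds_iff (x : PowCompletion A) (U : Set (PowCompletion A)) :
    U ∈ 𝓝 x ↔ ∃ n : ℕ+, {y : PowCompletion A | component n y = component n x} ⊆ U := by
  rw [nhds_eq_iInf_principal]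
  have hdir : Directed (· ≥ ·) fun n : ℕ+ => 𝓟 {y : PowCompletion A | component n y = component n x} := by
    intro m n
    refine ⟨m * n, ?_, ?_⟩
    · exact principal_mono.mpr (fiber_subset_of_dvd x (Dvd.intro (n : ℕ) rfl))
    · exact principal_mono.mpr (fiber_subset_of_dvd x (Dvd.intro_left (m : ℕ) rfl))
  rw [mem_iInf_of_directed hdir]
  simp only [mem_principal]

/-- **`η : A → Â` has DENSE image**: every component fibre — hence every neighbourhood of every point — meets `η(A)`, since
`A → A/Aⁿ` is onto. [cite: NeukirchANT1999, Ch. IV §2 p.274] -/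
theorem denseRange_of : DenseRange (of A) := by
  intro x
  rw [mem_closure_iff_nhds]
  intro U hU
  obtain ⟨n, hn⟩ := (mem_nhds_iff x U).mp hU
  obtain ⟨a, ha⟩ := QuotientGroup.mk_surjective (component n x)
  exact ⟨of A a, hn (by rw [Set.mem_setOf_eq, component_of, ha]), a, rfl⟩

/-- Every element of `Â` is approximated by `η(A)` on any prescribed component: `∃ a, η(a)_n = x_n`.
[cite: NeukirchANT1999, Ch. IV §2 p.274] -/
theorem exists_of_component_eq (x : PowCompletion A) (n : ℕ+) : ∃ a : A, component n (of A a) = component n x := by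
  obtain ⟨a, ha⟩ := QuotientGroup.mk_surjective (component n x)
  exact ⟨a, by rw [component_of, ha]⟩

end PowCompletion

namespace AbsTopMonoids.Genuine

open Literature.AnabelianGeometry.AbsoluteAnabelian

variable (C : MLFClosure.{0})

/-- Each level map `η_J : (k̄^×)^J → ((k̄^×)^J)^∧` has dense image: the (compact, p462628) level IS the profinite completion of the
`J`-invariants. [claim: Mochizuki2012, status: disputed] (IUTchII §1 Ex 1.8 (vii), kurims p.40) -/
theorem denseRange_of_level (i : GhatLevel C) :
    DenseRange (PowCompletion.of (fixedUnits C (i.J : Subgroup (C.K ≃ₐ[C.k] C.K)))) :=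
  PowCompletion.denseRange_of

/-- **`η(k̄^×)` is DENSE in `O^ĝp = lim→_J ((k̄^×)^J)^∧`** (colimit topology): every point lies on some level, in the closure of
`η` of that level's invariants, which `η : k̄^× → O^ĝp` hits. [claim: Mochizuki2012, status: disputed] (IUTchII §1 Ex 1.8 (vii), kurims p.40) -/
theorem denseRange_toOghat : DenseRange (toOghat C) := by
  intro z
  induction z using DirectLimit.induction with
  | ih i w =>
    change ofLevel C i w ∈ closure (Set.range (toOghat C))
    refine map_mem_closure (continuous_ofLevel C i) (denseRange_of_level C i w) ?_
    rintro _ ⟨a, rfl⟩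
    exact ⟨(a : (C.K)ˣ), toOghat_eq_ofLevel C a i a.2⟩

end AbsTopMonoids.Genuine

end Literature.IUT.HodgeArakelov

end
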